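import Literature.Probability.RandomPlanarGeometry.SLEImageDriverOneStep
import HarnessLib

/-!
# The image driving process of SLE_κ, one step (II): the conditional variance `κ h_t'(W_t)² h + o(h)`, the `*`-hull flow, and `κ = 6`

Sequel of `SLEImageDriverOneStep` ([LSW] 2003 §5, remark after (5.1): `dW̃_t = h_t'(W_t) dW_t +
(κ/2 − 3) h_t''(W_t) dt` for the image driving value `W̃_t = h_t(W_t)`; G. F. Lawler, O. Schramm,
W. Werner, Acta Math. **187** (2001), Thm. 2.2 — locality of SLE₆ — at `κ = 6`). With the good/bad
hypotheses of that file on a measurable version `Z` of the one-step increment `ΔW̃` (good event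
`{√κ sup_{[0,h]}|B| ≤ c}`: `|Z − imageDriverModel d c₂ h x| ≤ K(hη + h² + |x|³ + h|x|)`; everywhere
`|Z| ≤ M₀ + M₁ runSup h`) we PROVE

* `abs_integral_sq_sub_le` — **`|E[Z²] − κ d² h| ≤ imageStepC₂ · h √h`**: on the good event
  `|Z² − d²x²| ≤ 2α²h² + 2β²x⁴ + 2|d|(αh|x| + β|x|³)` (`abs_sq_sub_le_of_mem_goodEventK`,
  `α = 7K + 3|c₂|`, `β = K + |c₂|/2`), `E x⁴ = 3κ²h²`; on the bad event Cauchy–Schwarz with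
  `E runSup⁴ ≤ 18h²`. This is "`d⟨W̃⟩_t = κ h_t'(W_t)² dt`" for one step;
* the packaged statements for the flow of a `*`-hull `B₀` of a controlled class
  (`δ₀ ≤ Φ'_{B₀}(0)`, `B₀` off `B(0, 8ρ₀)`, `ρ₀ ≤ 1`; `c₀ = δ₀ρ₀/4000`, `32 h ≤ c₀²`, `32 κ h ≤ c₀²`):
  the good-event hypothesis is supplied by the deterministic expansion
  (`abs_imageDriverStep_sub_model_le_of_mem_goodEventK`, from
  `Loewner.abs_imageDriverStep_sub_model_le_clean`), whence
  `abs_integral_imageDriver_sub_drift_le` (`|E[Z] − h(κ/2 − 3)E_{B₀}''(0)| ≤ C h√h`) and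
  `abs_integral_imageDriver_sq_sub_le` (`|E[Z²] − κ Φ'_{B₀}(0)² h| ≤ C₂ h√h`);
* **`abs_integral_imageDriver_le_six`** — at `κ = 6` the drift vanishes (`imageDriverDrift_six`):
  `|E[Z]| ≤ C h √h`. Together: the conditional increments of `W̃ = h_t(W_t)` under SLE₆ have mean
  `o(h)` and variance `6 h_t'(W_t)² h + o(h)`, uniformly over a controlled class — the one-step
  skeleton of "`W̃` is a continuous local martingale with bracket `6 ∫ h_s'(W_s)² ds`", i.e. (after
  the time change by the capacity of the image) of the locality of SLE₆.

No named fact; one explicit constant (`imageStepC₂`).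

## References

* [LSW] 2003, §5, remark after (5.1). [LawlerSchrammWerner2003Restriction]
* G. F. Lawler, O. Schramm, W. Werner, Acta Math. 187 (2001), Thm. 2.2. [LawlerSchrammWerner2001]
* G. F. Lawler (2005), §6.3 Prop. 6.13. [Lawler2005]
* D. Revuz, M. Yor (1999), Ch. II Thm (1.7). [RevuzYor1999]
-/

noncomputable section

open Set Filter Metric Function MeasureTheory
open _root_.Complex _root_.Topology _root_.Real
open UpperHalfPlane (upperHalfPlaneSet)
open scoped NNReal ENNReal

namespace Literature.Probability.RandomPlanarGeometry

open Literature.Probability.Process Loewner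

/-! ### The one-step conditional variance, abstract form -/

section Abstract

variable {κ : ℝ≥0} {c : ℝ} {h : ℝ≥0} {d c₂ K M₀ M₁ : ℝ} {Z : (ℝ≥0 → ℝ) → ℝ}
variable (hκ : 0 < κ) (hc0 : 0 < c) (hc1 : c ≤ 1) (hh : 32 * (κ : ℝ) * h ≤ c ^ 2) (hh1 : (h : ℝ) ≤ 1)
  (hK : 0 ≤ K) (hM₀ : 0 ≤ M₀) (hM₁ : 0 ≤ M₁) (hZm : Measurable Z)
  (hgood : ∀ ω ∈ goodEventK κ c h, |Z ω - imageDriverModel d c₂ h (stepDriverK κ ω h)| ≤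
    K * (h * stepSize (Real.sqrt κ * runSup h ω) h + h ^ 2 + |stepDriverK κ ω h| ^ 3 + h * |stepDriverK κ ω h|))
  (hbad : ∀ ω, |Z ω| ≤ M₀ + M₁ * runSup h ω)

/-- **The constant of the second-moment estimate**: with `α = 7K + 3|c₂|`, `β = K + |c₂|/2`,
`s = √κ`, `p = 128κ²/c⁴`: `2α² + 6β²κ² + 2|d|α s + 4|d|β κ s + 2M₀² p + 10 M₁² √p + 2 d² κ √p`.
[folklore] -/
def imageStepC₂ (κ c d c₂ K M₀ M₁ : ℝ) : ℝ :=
  2 * (7 * K + 3 * |c₂|) ^ 2 + 6 * (K + |c₂| / 2) ^ 2 * κ ^ 2 + 2 * |d| * (7 * K + 3 * |c₂|) * Real.sqrt κ +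
    4 * |d| * (K + |c₂| / 2) * κ * Real.sqrt κ + 2 * M₀ ^ 2 * (128 * κ ^ 2 / c ^ 4) +
    10 * M₁ ^ 2 * Real.sqrt (128 * κ ^ 2 / c ^ 4) + 2 * d ^ 2 * κ * Real.sqrt (128 * κ ^ 2 / c ^ 4)

include hc1 hh1 hK hgood in
/-- **On the good event `|Z² − d² x²| ≤ 2α²h² + 2β² x⁴ + 2|d| (α h |x| + β |x|³)`**
(`α = 7K + 3|c₂|`, `β = K + |c₂|/2`): `|Z − d x| ≤ α h + β x²` (`|x| ≤ c ≤ 1`, `η ≤ 5`, `h ≤ 1`) and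
`|Z + d x| ≤ |Z − d x| + 2|d||x|`. [folklore] -/
theorem abs_sq_sub_le_of_mem_goodEventK {ω : ℝ≥0 → ℝ} (hω : ω ∈ goodEventK κ c h) :
    |Z ω ^ 2 - d ^ 2 * stepDriverK κ ω h ^ 2| ≤
      2 * (7 * K + 3 * |c₂|) ^ 2 * (h : ℝ) ^ 2 + 2 * (K + |c₂| / 2) ^ 2 * stepDriverK κ ω h ^ 4 +
        2 * |d| * ((7 * K + 3 * |c₂|) * h * |stepDriverK κ ω h| + (K + |c₂| / 2) * |stepDriverK κ ω h| ^ 3) := by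
  obtain ⟨hxc, hη⟩ := abs_le_of_mem_goodEventK hω
  set x : ℝ := stepDriverK κ ω h with hx
  set α : ℝ := 7 * K + 3 * |c₂| with hα
  set β : ℝ := K + |c₂| / 2 with hβ
  have hh0 : (0 : ℝ) ≤ h := h.coe_nonneg
  have hx0 : 0 ≤ |x| := abs_nonneg _
  have hx1 : |x| ≤ 1 := hxc.trans hc1
  have hsh1 : Real.sqrt h ≤ 1 := Real.sqrt_le_one.mpr hh1 |>.trans_eq' rfl
  have hη5 : stepSize (Real.sqrt κ * runSup h ω) h ≤ 5 := by linarith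
  have hη0 : 0 ≤ stepSize (Real.sqrt κ * runSup h ω) h := by
    rw [stepSize]; have := runSup_nonneg h ω; positivity
  have hα0 : 0 ≤ α := by positivity
  have hβ0 : 0 ≤ β := by positivity
  -- `|Z − d x| ≤ α h + β x²`
  have hR : |Z ω - d * x| ≤ α * h + β * x ^ 2 := by
    have h1 := hgood ω hω
    have hx3 : |x| ^ 3 ≤ x ^ 2 := by
      rw [show |x| ^ 3 = |x| ^ 2 * |x| by ring, sq_abs]; exact mul_le_of_le_one_right (sq_nonneg _) hx1
    have e1 : K * (h * stepSize (Real.sqrt κ * runSup h ω) h + h ^ 2 + |x| ^ 3 + h * |x|) ≤ 7 * K * h + K * x ^ 2 := by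
      have f1 : (h : ℝ) * stepSize (Real.sqrt κ * runSup h ω) h ≤ 5 * h := by nlinarith
      have f2 : (h : ℝ) ^ 2 ≤ h := by nlinarith
      have f3 : (h : ℝ) * |x| ≤ h := mul_le_of_le_one_right hh0 hx1
      have := mul_le_mul_of_nonneg_left (show h * stepSize (Real.sqrt κ * runSup h ω) h + h ^ 2 + |x| ^ 3 + h * |x| ≤
        7 * h + x ^ 2 by linarith) hK
      linarith
    have e2 : |imageDriverModel d c₂ h x - d * x| ≤ |c₂| / 2 * x ^ 2 + 3 * |c₂| * h := by
      rw [imageDriverModel, show d * x + c₂ * x ^ 2 / 2 - 3 * c₂ * ↑h - d * x = c₂ * x ^ 2 / 2 - 3 * c₂ * h by ring]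
      refine (abs_sub _ _).trans (add_le_add ?_ ?_)
      · rw [abs_div, abs_mul, abs_pow, sq_abs, abs_two]; exact le_of_eq (by ring)
      · rw [abs_mul, abs_mul, abs_of_nonneg hh0, show |(3 : ℝ)| = 3 by norm_num]
    calc |Z ω - d * x| = |(Z ω - imageDriverModel d c₂ h x) + (imageDriverModel d c₂ h x - d * x)| := by ring_nf
      _ ≤ |Z ω - imageDriverModel d c₂ h x| + |imageDriverModel d c₂ h x - d * x| := abs_add_le _ _
      _ ≤ (7 * K * h + K * x ^ 2) + (|c₂| / 2 * x ^ 2 + 3 * |c₂| * h) := add_le_add (h1.trans e1) e2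
      _ = α * h + β * x ^ 2 := by rw [hα, hβ]; ring
  have hR0 : 0 ≤ α * h + β * x ^ 2 := by positivity
  have hS : |Z ω + d * x| ≤ (α * h + β * x ^ 2) + 2 * |d| * |x| := by
    calc |Z ω + d * x| = |(Z ω - d * x) + 2 * (d * x)| := by ring_nf
      _ ≤ |Z ω - d * x| + |2 * (d * x)| := abs_add_le _ _
      _ ≤ _ := by rw [abs_mul, abs_two, abs_mul]; linarith
  have hprod : |Z ω ^ 2 - d ^ 2 * x ^ 2| = |Z ω - d * x| * |Z ω + d * x| := by
    rw [← abs_mul]; congr 1; ring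
  rw [hprod]
  calc |Z ω - d * x| * |Z ω + d * x| ≤ (α * h + β * x ^ 2) * ((α * h + β * x ^ 2) + 2 * |d| * |x|) :=
        mul_le_mul hR hS (abs_nonneg _) hR0
    _ = (α * h + β * x ^ 2) ^ 2 + 2 * |d| * (α * h * |x| + β * (x ^ 2 * |x|)) := by ring
    _ ≤ (2 * α ^ 2 * h ^ 2 + 2 * β ^ 2 * x ^ 4) + 2 * |d| * (α * h * |x| + β * |x| ^ 3) := by
        have e1 : (α * h + β * x ^ 2) ^ 2 ≤ 2 * α ^ 2 * h ^ 2 + 2 * β ^ 2 * x ^ 4 := by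
          nlinarith [sq_nonneg (α * h - β * x ^ 2)]
        have e2 : x ^ 2 * |x| = |x| ^ 3 := by rw [← sq_abs]; ring
        rw [e2]
        linarith
    _ = _ := by ring

include hκ hc0 hc1 hh hh1 hK hM₀ hM₁ hZm hgood hbad in
/-- **The one-step conditional second moment, abstract form**: under the good/bad hypotheses,

  `|E[Z²] − κ d² h| ≤ imageStepC₂ κ c d c₂ K M₀ M₁ · h √h`

(`E[d² x²] = κ d² h`; on the good event `abs_sq_sub_le_of_mem_goodEventK` with `E x⁴ = 3κ²h²`,
`E|x| ≤ √κ√h`, `E|x|³ ≤ 2κ√κ h√h`; on the bad event `Z² + d²x² ≤ 2M₀² + 2M₁² runSup² + d² x²` is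
integrated by Cauchy–Schwarz). This is "`d⟨W̃⟩_t = κ h_t'(W_t)² dt`" for one step.
[cite: LawlerSchrammWerner2003Restriction, §5 (remark after (5.1))] -/
theorem abs_integral_sq_sub_le :
    |∫ ω, Z ω ^ 2 ∂preWienerMeasure - κ * d ^ 2 * h| ≤ imageStepC₂ κ c d c₂ K M₀ M₁ * h * Real.sqrt h := by
  haveI := isProbabilityMeasure_preWienerMeasure'
  obtain ⟨e1, e3, e4, i3, i4, -, -⟩ := moments_stepDriverK κ h
  obtain ⟨-, e2, i1, i2⟩ := integral_stepDriverK κ h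
  obtain ⟨hP, -, -, hX2, hRS2⟩ := setIntegral_compl_goodEventK_le (κ := κ) (c := c) (h := h) hκ hc0 hh
  have hG := measurableSet_goodEventK κ c h
  have hh0 : (0 : ℝ) ≤ h := h.coe_nonneg
  have hs0 : 0 ≤ Real.sqrt κ := Real.sqrt_nonneg _
  have hsh : 0 ≤ Real.sqrt h := Real.sqrt_nonneg _
  have hhs : (h : ℝ) ≤ Real.sqrt h := by rw [Real.le_sqrt hh0 hh0]; nlinarith
  have hh2 : (h : ℝ) ^ 2 ≤ h * Real.sqrt h := by nlinarith
  set p : ℝ := 128 * (κ : ℝ) ^ 2 / c ^ 4 with hp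
  have hp0 : 0 ≤ p := by positivity
  set α : ℝ := 7 * K + 3 * |c₂| with hα
  set β : ℝ := K + |c₂| / 2 with hβ
  have hα0 : 0 ≤ α := by positivity
  have hβ0 : 0 ≤ β := by positivity
  -- integrability of `Z²`
  have iZ2 : Integrable (fun ω ↦ Z ω ^ 2) preWienerMeasure := by
    refine (((integrable_const (2 * M₀ ^ 2)).add ((integrable_runSup_sq h).const_mul (2 * M₁ ^ 2))).mono'
      (hZm.pow_const 2).aestronglyMeasurable (Eventually.of_forall fun ω ↦ ?_))
    rw [Real.norm_eq_abs, abs_of_nonneg (sq_nonneg _), Pi.add_apply]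
    have h1 := hbad ω
    have h0 : 0 ≤ M₀ + M₁ * runSup h ω := by have := runSup_nonneg h ω; positivity
    have h2 : Z ω ^ 2 ≤ (M₀ + M₁ * runSup h ω) ^ 2 := by
      rw [← sq_abs (Z ω)]; exact pow_le_pow_left₀ (abs_nonneg _) h1 2
    nlinarith only [h2, sq_nonneg (M₀ - M₁ * runSup h ω)]
  have iX : Integrable (fun ω ↦ d ^ 2 * stepDriverK κ ω h ^ 2) preWienerMeasure := i2.const_mul _
  set G : (ℝ≥0 → ℝ) → ℝ := fun ω ↦ Z ω ^ 2 - d ^ 2 * stepDriverK κ ω h ^ 2 with hGdef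
  have iG : Integrable G preWienerMeasure := iZ2.sub iX
  have hdec : ∫ ω, Z ω ^ 2 ∂preWienerMeasure - κ * d ^ 2 * h = ∫ ω, G ω ∂preWienerMeasure := by
    rw [hGdef, integral_sub iZ2 iX, integral_const_mul, e2]; ring
  rw [hdec]
  -- good event
  have iA : Integrable (fun ω ↦ 2 * α ^ 2 * (h : ℝ) ^ 2 + 2 * β ^ 2 * stepDriverK κ ω h ^ 4) preWienerMeasure :=
    (integrable_const _).add (i4.const_mul _)
  have iB1 : Integrable (fun ω ↦ α * h * |stepDriverK κ ω h|) preWienerMeasure := i1.abs.const_mul _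
  have iB2 : Integrable (fun ω ↦ β * |stepDriverK κ ω h| ^ 3) preWienerMeasure := i3.const_mul _
  have iB12 : Integrable (fun ω ↦ α * h * |stepDriverK κ ω h| + β * |stepDriverK κ ω h| ^ 3) preWienerMeasure :=
    iB1.add iB2
  have iB : Integrable (fun ω ↦ 2 * |d| * (α * h * |stepDriverK κ ω h| + β * |stepDriverK κ ω h| ^ 3))
      preWienerMeasure := iB12.const_mul _
  have iGood : Integrable (fun ω ↦ 2 * α ^ 2 * (h : ℝ) ^ 2 + 2 * β ^ 2 * stepDriverK κ ω h ^ 4 +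
      2 * |d| * (α * h * |stepDriverK κ ω h| + β * |stepDriverK κ ω h| ^ 3)) preWienerMeasure := iA.add iB
  have hgoodInt : ∫ ω in goodEventK κ c h, |G ω| ∂preWienerMeasure ≤
      (2 * α ^ 2 + 6 * β ^ 2 * κ ^ 2 + 2 * |d| * α * Real.sqrt κ + 4 * |d| * β * κ * Real.sqrt κ) * h * Real.sqrt h := by
    have hpos : ∀ ω, 0 ≤ 2 * α ^ 2 * (h : ℝ) ^ 2 + 2 * β ^ 2 * stepDriverK κ ω h ^ 4 +
        2 * |d| * (α * h * |stepDriverK κ ω h| + β * |stepDriverK κ ω h| ^ 3) := fun ω ↦ by positivity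
    have hint : ∫ ω, (2 * α ^ 2 * (h : ℝ) ^ 2 + 2 * β ^ 2 * stepDriverK κ ω h ^ 4 +
        2 * |d| * (α * h * |stepDriverK κ ω h| + β * |stepDriverK κ ω h| ^ 3)) ∂preWienerMeasure ≤
        (2 * α ^ 2 + 6 * β ^ 2 * κ ^ 2 + 2 * |d| * α * Real.sqrt κ + 4 * |d| * β * κ * Real.sqrt κ) * h * Real.sqrt h := by
      have hi4 : Integrable (fun ω ↦ 2 * β ^ 2 * stepDriverK κ ω h ^ 4) preWienerMeasure := i4.const_mul _
      have hI1 : ∫ ω, (2 * α ^ 2 * (h : ℝ) ^ 2 + 2 * β ^ 2 * stepDriverK κ ω h ^ 4) ∂preWienerMeasure =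
          2 * α ^ 2 * (h : ℝ) ^ 2 + 2 * β ^ 2 * (3 * (κ : ℝ) ^ 2 * (h : ℝ) ^ 2) := by
        rw [integral_add (integrable_const _) hi4, integral_const, integral_const_mul, e4]
        simp only [probReal_univ, smul_eq_mul, one_mul]
      have hI2 : ∫ ω, 2 * |d| * (α * h * |stepDriverK κ ω h| + β * |stepDriverK κ ω h| ^ 3) ∂preWienerMeasure =
          2 * |d| * (α * h * ∫ ω, |stepDriverK κ ω h| ∂preWienerMeasure + β * ∫ ω, |stepDriverK κ ω h| ^ 3 ∂preWienerMeasure) := by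
        rw [integral_const_mul, integral_add iB1 iB2, integral_const_mul, integral_const_mul]
      have f1 : α * (h : ℝ) * ∫ ω, |stepDriverK κ ω h| ∂preWienerMeasure ≤ α * h * (Real.sqrt κ * Real.sqrt h) :=
        mul_le_mul_of_nonneg_left e1 (by positivity)
      have f3 : β * ∫ ω, |stepDriverK κ ω h| ^ 3 ∂preWienerMeasure ≤ β * (2 * κ * Real.sqrt κ * h * Real.sqrt h) :=
        mul_le_mul_of_nonneg_left e3 hβ0
      have f4 : 2 * β ^ 2 * (3 * (κ : ℝ) ^ 2 * (h : ℝ) ^ 2) ≤ 2 * β ^ 2 * (3 * (κ : ℝ) ^ 2 * (h * Real.sqrt h)) := by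
        gcongr
      have f5 : 2 * α ^ 2 * (h : ℝ) ^ 2 ≤ 2 * α ^ 2 * (h * Real.sqrt h) := mul_le_mul_of_nonneg_left hh2 (by positivity)
      have f6 := mul_le_mul_of_nonneg_left (add_le_add f1 f3) (by positivity : (0 : ℝ) ≤ 2 * |d|)
      calc ∫ ω, (2 * α ^ 2 * (h : ℝ) ^ 2 + 2 * β ^ 2 * stepDriverK κ ω h ^ 4 +
            2 * |d| * (α * h * |stepDriverK κ ω h| + β * |stepDriverK κ ω h| ^ 3)) ∂preWienerMeasure
          = (2 * α ^ 2 * (h : ℝ) ^ 2 + 2 * β ^ 2 * (3 * (κ : ℝ) ^ 2 * (h : ℝ) ^ 2)) +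
            2 * |d| * (α * h * ∫ ω, |stepDriverK κ ω h| ∂preWienerMeasure +
              β * ∫ ω, |stepDriverK κ ω h| ^ 3 ∂preWienerMeasure) := by rw [integral_add iA iB, hI1, hI2]
        _ ≤ (2 * α ^ 2 * (h * Real.sqrt h) + 2 * β ^ 2 * (3 * (κ : ℝ) ^ 2 * (h * Real.sqrt h))) +
            2 * |d| * (α * h * (Real.sqrt κ * Real.sqrt h) + β * (2 * κ * Real.sqrt κ * h * Real.sqrt h)) :=
            add_le_add (add_le_add f5 f4) f6
        _ = _ := by ring
    calc ∫ ω in goodEventK κ c h, |G ω| ∂preWienerMeasure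
        ≤ ∫ ω in goodEventK κ c h, (2 * α ^ 2 * (h : ℝ) ^ 2 + 2 * β ^ 2 * stepDriverK κ ω h ^ 4 +
            2 * |d| * (α * h * |stepDriverK κ ω h| + β * |stepDriverK κ ω h| ^ 3)) ∂preWienerMeasure :=
          setIntegral_mono_on iG.abs.integrableOn iGood.integrableOn hG fun ω hω ↦
            abs_sq_sub_le_of_mem_goodEventK (κ := κ) (c := c) (h := h) (d := d) (c₂ := c₂) (K := K) (Z := Z)
              hc1 hh1 hK hgood hω
      _ ≤ ∫ ω, (2 * α ^ 2 * (h : ℝ) ^ 2 + 2 * β ^ 2 * stepDriverK κ ω h ^ 4 +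
            2 * |d| * (α * h * |stepDriverK κ ω h| + β * |stepDriverK κ ω h| ^ 3)) ∂preWienerMeasure :=
          setIntegral_le_integral iGood (Eventually.of_forall hpos)
      _ ≤ _ := hint
  -- bad event
  have iR2 : Integrable (fun ω ↦ 2 * M₁ ^ 2 * runSup h ω ^ 2) preWienerMeasure := (integrable_runSup_sq h).const_mul _
  have iC1 : Integrable (fun ω ↦ 2 * M₀ ^ 2 + 2 * M₁ ^ 2 * runSup h ω ^ 2) preWienerMeasure := (integrable_const _).add iR2
  have iBad : Integrable (fun ω ↦ 2 * M₀ ^ 2 + 2 * M₁ ^ 2 * runSup h ω ^ 2 + d ^ 2 * stepDriverK κ ω h ^ 2)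
      preWienerMeasure := iC1.add iX
  have hGbad : ∀ ω, |G ω| ≤ 2 * M₀ ^ 2 + 2 * M₁ ^ 2 * runSup h ω ^ 2 + d ^ 2 * stepDriverK κ ω h ^ 2 := by
    intro ω
    have h1 := hbad ω
    have h0 : 0 ≤ M₀ + M₁ * runSup h ω := by have := runSup_nonneg h ω; positivity
    have h2 : Z ω ^ 2 ≤ (M₀ + M₁ * runSup h ω) ^ 2 := by
      rw [← sq_abs (Z ω)]; exact pow_le_pow_left₀ (abs_nonneg _) h1 2
    have h3 : |G ω| ≤ Z ω ^ 2 + d ^ 2 * stepDriverK κ ω h ^ 2 := by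
      simp only [hGdef]
      refine (abs_sub _ _).trans ?_
      rw [abs_of_nonneg (sq_nonneg _), abs_of_nonneg (by positivity)]
    nlinarith only [h2, h3, sq_nonneg (M₀ - M₁ * runSup h ω)]
  have hbadInt : ∫ ω in (goodEventK κ c h)ᶜ, |G ω| ∂preWienerMeasure ≤
      (2 * M₀ ^ 2 * p + 10 * M₁ ^ 2 * Real.sqrt p + 2 * d ^ 2 * κ * Real.sqrt p) * h * Real.sqrt h := by
    have hdom : ∫ ω in (goodEventK κ c h)ᶜ, |G ω| ∂preWienerMeasure ≤
        ∫ ω in (goodEventK κ c h)ᶜ, (2 * M₀ ^ 2 + 2 * M₁ ^ 2 * runSup h ω ^ 2 + d ^ 2 * stepDriverK κ ω h ^ 2) ∂preWienerMeasure :=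
      setIntegral_mono_on iG.abs.integrableOn iBad.integrableOn hG.compl fun ω _ ↦ hGbad ω
    have hsplit : ∫ ω in (goodEventK κ c h)ᶜ, (2 * M₀ ^ 2 + 2 * M₁ ^ 2 * runSup h ω ^ 2 + d ^ 2 * stepDriverK κ ω h ^ 2)
        ∂preWienerMeasure = preWienerMeasure.real (goodEventK κ c h)ᶜ * (2 * M₀ ^ 2) +
          2 * M₁ ^ 2 * ∫ ω in (goodEventK κ c h)ᶜ, runSup h ω ^ 2 ∂preWienerMeasure +
          d ^ 2 * ∫ ω in (goodEventK κ c h)ᶜ, stepDriverK κ ω h ^ 2 ∂preWienerMeasure := by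
      rw [integral_add iC1.integrableOn iX.integrableOn, integral_add (integrable_const _).integrableOn iR2.integrableOn,
        setIntegral_const, integral_const_mul, integral_const_mul, smul_eq_mul]
    have t1 : preWienerMeasure.real (goodEventK κ c h)ᶜ * (2 * M₀ ^ 2) ≤ 2 * M₀ ^ 2 * p * h * Real.sqrt h := by
      calc preWienerMeasure.real (goodEventK κ c h)ᶜ * (2 * M₀ ^ 2) ≤ p * (h : ℝ) ^ 2 * (2 * M₀ ^ 2) :=
            mul_le_mul_of_nonneg_right hP (by positivity)
        _ = 2 * M₀ ^ 2 * p * (h : ℝ) ^ 2 := by ring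
        _ ≤ 2 * M₀ ^ 2 * p * (h * Real.sqrt h) := mul_le_mul_of_nonneg_left hh2 (by positivity)
        _ = _ := by ring
    have t2 : 2 * M₁ ^ 2 * ∫ ω in (goodEventK κ c h)ᶜ, runSup h ω ^ 2 ∂preWienerMeasure ≤
        10 * M₁ ^ 2 * Real.sqrt p * h * Real.sqrt h := by
      calc 2 * M₁ ^ 2 * ∫ ω in (goodEventK κ c h)ᶜ, runSup h ω ^ 2 ∂preWienerMeasure
          ≤ 2 * M₁ ^ 2 * (5 * Real.sqrt p * (h : ℝ) ^ 2) := mul_le_mul_of_nonneg_left hRS2 (by positivity)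
        _ = 10 * M₁ ^ 2 * Real.sqrt p * (h : ℝ) ^ 2 := by ring
        _ ≤ 10 * M₁ ^ 2 * Real.sqrt p * (h * Real.sqrt h) := mul_le_mul_of_nonneg_left hh2 (by positivity)
        _ = _ := by ring
    have t3 : d ^ 2 * ∫ ω in (goodEventK κ c h)ᶜ, stepDriverK κ ω h ^ 2 ∂preWienerMeasure ≤
        2 * d ^ 2 * κ * Real.sqrt p * h * Real.sqrt h := by
      calc d ^ 2 * ∫ ω in (goodEventK κ c h)ᶜ, stepDriverK κ ω h ^ 2 ∂preWienerMeasure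
          ≤ d ^ 2 * (2 * κ * Real.sqrt p * (h : ℝ) ^ 2) := mul_le_mul_of_nonneg_left hX2 (sq_nonneg _)
        _ = 2 * d ^ 2 * κ * Real.sqrt p * (h : ℝ) ^ 2 := by ring
        _ ≤ 2 * d ^ 2 * κ * Real.sqrt p * (h * Real.sqrt h) := mul_le_mul_of_nonneg_left hh2 (by positivity)
        _ = _ := by ring
    calc _ ≤ _ := hdom
      _ = _ := hsplit
      _ ≤ 2 * M₀ ^ 2 * p * h * Real.sqrt h + 10 * M₁ ^ 2 * Real.sqrt p * h * Real.sqrt h +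
          2 * d ^ 2 * κ * Real.sqrt p * h * Real.sqrt h := add_le_add (add_le_add t1 t2) t3
      _ = _ := by ring
  -- assemble
  have h1 : |∫ ω, G ω ∂preWienerMeasure| ≤ ∫ ω, |G ω| ∂preWienerMeasure := abs_integral_le_integral_abs
  rw [← integral_add_compl hG iG.abs] at h1
  have hC : (2 * α ^ 2 + 6 * β ^ 2 * κ ^ 2 + 2 * |d| * α * Real.sqrt κ + 4 * |d| * β * κ * Real.sqrt κ) * h * Real.sqrt h +
      (2 * M₀ ^ 2 * p + 10 * M₁ ^ 2 * Real.sqrt p + 2 * d ^ 2 * κ * Real.sqrt p) * h * Real.sqrt h =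
      imageStepC₂ κ c d c₂ K M₀ M₁ * h * Real.sqrt h := by
    rw [imageStepC₂, hp, hα, hβ]; ring
  linarith

end Abstract

/-! ### The image driving value of the flow of a `*`-hull: the packaged one-step statements -/

section Hull

variable {B₀ : Set ℂ} {ρ₀ δ₀ : ℝ} {h : ℝ≥0} {κ : ℝ≥0}
variable (hB : IsStarHull B₀) (hρ₀ : 0 < ρ₀) (hρ1 : ρ₀ ≤ 1) (hBρ : Disjoint (ball (0 : ℂ) (8 * ρ₀)) B₀)
  (hδ0 : 0 < δ₀) (hδ : δ₀ ≤ starDeriv B₀) (hh0 : 0 < h) (hh : 32 * (h : ℝ) ≤ (δ₀ * ρ₀ / 4000) ^ 2)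

include hB hρ₀ hρ1 hδ0 hδ hh in
/-- Smallness: with `c₀ = δ₀ρ₀/4000`: `0 < c₀ ≤ 1/4000`, `4√h ≤ c₀`, `h ≤ 1`. [folklore] -/
theorem imageStep_hull_smallness : 0 < δ₀ * ρ₀ / 4000 ∧ δ₀ * ρ₀ / 4000 ≤ 1 / 4000 ∧
    4 * Real.sqrt h ≤ δ₀ * ρ₀ / 4000 ∧ (h : ℝ) ≤ 1 := by
  obtain ⟨hd0, hd1, -⟩ := starDeriv_spec hB
  have hδ1 : δ₀ ≤ 1 := hδ.trans hd1
  have hc0 : 0 < δ₀ * ρ₀ / 4000 := by positivity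
  have hc1 : δ₀ * ρ₀ / 4000 ≤ 1 / 4000 := by
    rw [div_le_div_iff_of_pos_right (by norm_num)]
    have := mul_le_mul hδ1 hρ1 hρ₀.le zero_le_one
    linarith
  have hh0' : (0 : ℝ) ≤ h := h.coe_nonneg
  have hh16 : (h : ℝ) ≤ (δ₀ * ρ₀ / 4000 / 4) ^ 2 := by nlinarith
  have hsqrt : Real.sqrt h ≤ δ₀ * ρ₀ / 4000 / 4 := by
    rw [Real.sqrt_le_left (by positivity)]; exact hh16
  exact ⟨hc0, hc1, by linarith, by nlinarith⟩

include hB hρ₀ hρ1 hBρ hδ0 hδ hh0 hh in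
/-- **On the good event the clean deterministic expansion applies to the SLE_κ step**: for
`ω ∈ {√κ sup_{[0,h]}|B| ≤ c₀}`, `c₀ = δ₀ρ₀/4000`, the increment driver `U = √κ B(ω)` has
`η = stepSize (√κ runSup) h ≤ 2c₀ ≤ Φ'_{B₀}(0) ρ₀/1000`, so `abs_imageDriverStep_sub_model_le_clean`
gives `|ΔW̃(ω) − model(x(ω))| ≤ stepK δ₀ ρ₀ (h η + h² + |x|³ + h|x|)`. [folklore] -/
theorem abs_imageDriverStep_sub_model_le_of_mem_goodEventK {ω : ℝ≥0 → ℝ}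
    (hω : ω ∈ goodEventK κ (δ₀ * ρ₀ / 4000) h) :
    |imageDriverStep B₀ (stepDriverK κ ω) h - imageDriverModel (starDeriv B₀) (starJet2 B₀) h (stepDriverK κ ω h)| ≤
      stepK δ₀ ρ₀ * (h * stepSize (Real.sqrt κ * runSup h ω) h + h ^ 2 + |stepDriverK κ ω h| ^ 3 +
        h * |stepDriverK κ ω h|) := by
  obtain ⟨hc0, hc1, h4, hh1⟩ := imageStep_hull_smallness hB hρ₀ hρ1 hδ0 hδ hh
  obtain ⟨hUc, hU0⟩ := continuous_stepDriverK κ ω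
  have hS : ∀ v : ℝ≥0, v ≤ h → |stepDriverK κ ω v| ≤ Real.sqrt κ * runSup h ω :=
    fun v hv ↦ abs_stepDriverK_le_sqrt_mul_runSup κ hv ω
  have hω' : Real.sqrt κ * runSup h ω ≤ δ₀ * ρ₀ / 4000 := hω
  have hη2 : stepSize (Real.sqrt κ * runSup h ω) h ≤ 2 * (δ₀ * ρ₀ / 4000) := by rw [stepSize]; linarith
  have hη : stepSize (Real.sqrt κ * runSup h ω) h ≤ starDeriv B₀ * ρ₀ / 1000 := by
    refine hη2.trans ?_
    rw [show 2 * (δ₀ * ρ₀ / 4000) = δ₀ * ρ₀ / 2000 by ring, div_le_div_iff₀ (by norm_num) (by norm_num)]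
    nlinarith [mul_le_mul_of_nonneg_right hδ hρ₀.le]
  have hη1 : stepSize (Real.sqrt κ * runSup h ω) h ≤ 1 := by linarith
  exact abs_imageDriverStep_sub_model_le_clean hB hUc hU0 hh0 hS hρ₀ hBρ hη hρ1 hδ0 hδ hη1

variable {Z : (ℝ≥0 → ℝ) → ℝ} {M₀ M₁ : ℝ} (hκ : 0 < κ) (hhκ : 32 * (κ : ℝ) * h ≤ (δ₀ * ρ₀ / 4000) ^ 2)
  (hM₀ : 0 ≤ M₀) (hM₁ : 0 ≤ M₁) (hZm : Measurable Z)
  (hZeq : ∀ ω ∈ goodEventK κ (δ₀ * ρ₀ / 4000) h, Z ω = imageDriverStep B₀ (stepDriverK κ ω) h)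
  (hbad : ∀ ω, |Z ω| ≤ M₀ + M₁ * runSup h ω)

include hB hρ₀ hρ1 hBρ hδ0 hδ hh0 hh hκ hhκ hM₀ hM₁ hZm hZeq hbad in
/-- **One step of the image driving process of the SLE_κ flow of a `*`-hull: the conditional
mean.** For `B₀` in the controlled class (`δ₀ ≤ Φ'_{B₀}(0)`, `B₀` off `B(0, 8ρ₀)`, `ρ₀ ≤ 1`), a step
`h` with `32 h ≤ c₀²`, `32 κ h ≤ c₀²` (`c₀ = δ₀ρ₀/4000`), and any measurable `Z` equal to
`ΔW̃ = imageDriverStep B₀ (√κ B) h` on the good event and dominated by `M₀ + M₁ runSup h`: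

  `|E[Z] − h (κ/2 − 3) E_{B₀}''(0)| ≤ imageStepC κ c₀ (Φ'_{B₀}(0)) (E_{B₀}''(0)) (stepK δ₀ ρ₀) M₀ M₁ · h √h`.

In [LSW]'s notation `E[W̃_{t+h} − W̃_t | 𝓕_t] = (κ/2 − 3) h_t''(W_t) h + o(h)`.
[cite: LawlerSchrammWerner2003Restriction, §5 (remark after (5.1))] -/
theorem abs_integral_imageDriver_sub_drift_le :
    |∫ ω, Z ω ∂preWienerMeasure - h * imageDriverDrift κ (starJet2 B₀)| ≤
      imageStepC κ (δ₀ * ρ₀ / 4000) (starDeriv B₀) (starJet2 B₀) (stepK δ₀ ρ₀) M₀ M₁ * h * Real.sqrt h := by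
  obtain ⟨hc0, hc1, -, hh1⟩ := imageStep_hull_smallness hB hρ₀ hρ1 hδ0 hδ hh
  have hK : 0 ≤ stepK δ₀ ρ₀ := by rw [stepK]; positivity
  refine abs_integral_sub_drift_le hκ hc0 hhκ hh1 hK hM₀ hM₁ hZm (fun ω hω ↦ ?_) hbad
  rw [hZeq ω hω]
  exact abs_imageDriverStep_sub_model_le_of_mem_goodEventK hB hρ₀ hρ1 hBρ hδ0 hδ hh0 hh hω

include hB hρ₀ hρ1 hBρ hδ0 hδ hh0 hh hκ hhκ hM₀ hM₁ hZm hZeq hbad in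
/-- **One step: the conditional second moment**, `|E[Z²] − κ Φ'_{B₀}(0)² h| ≤ C₂ h √h`
(`E[(W̃_{t+h} − W̃_t)² | 𝓕_t] = κ h_t'(W_t)² h + o(h)`: the bracket of `W̃` grows at rate
`κ h_t'(W_t)²`). [cite: LawlerSchrammWerner2003Restriction, §5 (remark after (5.1))] -/
theorem abs_integral_imageDriver_sq_sub_le :
    |∫ ω, Z ω ^ 2 ∂preWienerMeasure - κ * starDeriv B₀ ^ 2 * h| ≤
      imageStepC₂ κ (δ₀ * ρ₀ / 4000) (starDeriv B₀) (starJet2 B₀) (stepK δ₀ ρ₀) M₀ M₁ * h * Real.sqrt h := by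
  obtain ⟨hc0, hc1, -, hh1⟩ := imageStep_hull_smallness hB hρ₀ hρ1 hδ0 hδ hh
  have hK : 0 ≤ stepK δ₀ ρ₀ := by rw [stepK]; positivity
  refine abs_integral_sq_sub_le hκ hc0 (hc1.trans (by norm_num)) hhκ hh1 hK hM₀ hM₁ hZm (fun ω hω ↦ ?_) hbad
  rw [hZeq ω hω]
  exact abs_imageDriverStep_sub_model_le_of_mem_goodEventK hB hρ₀ hρ1 hBρ hδ0 hδ hh0 hh hω

end Hull

/-! ### `κ = 6`: the conditional mean is `o(h)` — locality of SLE₆ for one step -/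

section Six

variable {B₀ : Set ℂ} {ρ₀ δ₀ : ℝ} {h : ℝ≥0} {Z : (ℝ≥0 → ℝ) → ℝ} {M₀ M₁ : ℝ}
variable (hB : IsStarHull B₀) (hρ₀ : 0 < ρ₀) (hρ1 : ρ₀ ≤ 1) (hBρ : Disjoint (ball (0 : ℂ) (8 * ρ₀)) B₀)
  (hδ0 : 0 < δ₀) (hδ : δ₀ ≤ starDeriv B₀) (hh0 : 0 < h) (hh : 192 * (h : ℝ) ≤ (δ₀ * ρ₀ / 4000) ^ 2)
  (hM₀ : 0 ≤ M₀) (hM₁ : 0 ≤ M₁) (hZm : Measurable Z)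
  (hZeq : ∀ ω ∈ goodEventK 6 (δ₀ * ρ₀ / 4000) h, Z ω = imageDriverStep B₀ (stepDriverK 6 ω) h)
  (hbad : ∀ ω, |Z ω| ≤ M₀ + M₁ * runSup h ω)

include hB hρ₀ hρ1 hBρ hδ0 hδ hh0 hh hM₀ hM₁ hZm hZeq hbad in
/-- **Locality of SLE₆, one step of the driving process.** At `κ = 6` the drift
`(κ/2 − 3) h_t''(W_t)` vanishes (`imageDriverDrift_six`), so for the flow of a controlled `*`-hull
under the SLE₆ driving function `√6 B` and `192 h ≤ c₀²`:

  `|E[Z]| ≤ imageStepC 6 c₀ (Φ'_{B₀}(0)) (E_{B₀}''(0)) (stepK δ₀ ρ₀) M₀ M₁ · h √h`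

for every measurable `Z` equal to the increment `ΔW̃` of the image driving value on the good event
and dominated by `M₀ + M₁ runSup h`: the conditional increments of `W̃ = h_t(W_t)` have mean
`o(h)`, uniformly over the controlled class — the one-step form of "`W̃` is a local martingale",
[LSW] 2003 §5 / [LSW] 2001 Thm. 2.2. [cite: LawlerSchrammWerner2001, Thm 2.2] -/
theorem abs_integral_imageDriver_le_six :
    |∫ ω, Z ω ∂preWienerMeasure| ≤
      imageStepC 6 (δ₀ * ρ₀ / 4000) (starDeriv B₀) (starJet2 B₀) (stepK δ₀ ρ₀) M₀ M₁ * h * Real.sqrt h := by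
  have h6 : 32 * ((6 : ℝ≥0) : ℝ) * h ≤ (δ₀ * ρ₀ / 4000) ^ 2 := by push_cast; linarith
  have h1 : 32 * (h : ℝ) ≤ (δ₀ * ρ₀ / 4000) ^ 2 := by have := h.coe_nonneg; linarith
  have := abs_integral_imageDriver_sub_drift_le hB hρ₀ hρ1 hBρ hδ0 hδ hh0 h1 (by norm_num) h6 hM₀ hM₁ hZm hZeq hbad
  rwa [show ((6 : ℝ≥0) : ℝ) = 6 by norm_num, imageDriverDrift_six, mul_zero, sub_zero] at this

end Six

end Literature.Probability.RandomPlanarGeometry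

end
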